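/-
Copyright (c) 2026 the pub-hodgecm-mathlib formalisation cell (harness21).  Prover seat hodgecm-mathlib-K2E3-p03 (g0), HCML Track B «K2-LIT», row #3 of SIGS-TABLE-K2E3
(`sig_K2E3GermResidueAtCubicTorus`); 2026-09-03.
-/
import Summits.HodgeConjecture.HodgeConjecture.Theorems.F0P3cStCharTSEPGlueGNotWild   -- ★ (G3)-NOT-WILD `exists_epFunction_G_of_not_wild` (Kottwitz's Euler–Poincaré function on `U(Φ₃)(L⁺_v)`)
import Summits.HodgeConjecture.HodgeConjecture.Theorems.K2E3EPFunctionGWild           -- ★ p854998 (K2E3-p21) row #21 `epFunctionGWild` (the same at the WILDLY ramified places) — ED. 2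
import Literature.NumberTheory.Rogawski1990.ShalikaGermHomogeneityNonsplit           -- ★ the residue predicate `ShalikaGermResidueAtTorus` (+ `ShalikaGermExpansionNonsplit` vocabulary)
import Literature.LinearAlgebra.Matrix.CentraliserOfSeparableCharpoly                 -- ★ `Subgroup.mul_comm_of_mem_centralizer_of_charpoly_separable`
import Literature.LinearAlgebra.Matrix.RegularSemisimpleConjClassClosed               -- ★ `continuous_charpoly_coeff`
import HarnessLib

/-!
# K2 · E3 — `Theorems/K2E3GermResidueAtCubicTorusOfHomogeneity.lean`: THE RESIDUE OF THE GERM EXPANSION ALONG A COMPACT CARTAN SUBGROUP,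
# REDUCED TO HOMOGENEITY OF THE NON-TRIVIAL GERMS ALONG ONE RAY (the trivial germ is eliminated by Kottwitz's Euler–Poincaré function)
# (Rogawski 1990, §8.1 Prop. 8.1.1, Prop. 8.1.2 (b), (8.1.1)–(8.1.2) p. 116; §12.7 p. 194; Kottwitz 1988 §2 Thm. 2)

HCML Track B «K2-LIT», cell `pub/hodgecm-mathlib`, crux H413 = `stmt-HodgeConjecture-24833` (lane `--supports … --as helper`), seat `hodgecm-mathlib-K2E3-p03` (g0),
dealt file = row #3 `sig_K2E3GermResidueAtCubicTorus` (XL) of `Cruxes/H413/Lines/K2_E3_EllipticInputsSigs_U3CubicGerms.lean`, whose conclusion is the named residue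
★ `Literature.NumberTheory.Rogawski1990.ShalikaGermResidueAtTorus L Φ₃ v mQv T`.  THIS FILE is the REDUCTION of that conclusion to its one printed input that the tree
does not yet hold in any currency — HOMOGENEITY of the non-trivial Shalika germs along ONE ray of regular elements of `T` tending to `1` [Rogawski1990, Prop. 8.1.2 (b);
HarishChandra1999, Thm. 8.1 (1)] — everything else being ★: the germ EXPANSION (★ `ShalikaGermExpansionNonsplit`, in tree even hypothesis-free: ★
`UnitaryGroup.shalikaGermExpansionNonsplit_antidiagOne_three`) and, in place of [R₁] (the value `Γ₁ ≡ (−1)^q d(St)⁻¹ ≠ 0` of the trivial germ on an elliptic torus),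
KOTTWITZ'S EULER–POINCARÉ FUNCTION ★ `F0P3cStCharTSEPGlueGNotWild.exists_epFunction_G_of_not_wild` (`f_G ∈ C_c^∞`, `f_G(1)` real `< 0`, canonical orbital integral `1` at
every regular class with compact centraliser), available at every non-split place that is not wildly ramified.

THE MATHEMATICS.  Let `(S, m_U, Γ)` be an expansion datum near `1`: `Φ(c, h) = Σ_{u ∈ S} Φ_U(u, h)·Γ_u(c)` for `h ∈ C_c^∞` and regular classes `c` with characteristic
polynomial near `(X − 1)³` (the last conjunct of ★ `ShalikaGermExpansionNonsplit`, verbatim).  For `γ ∈ T` regular, `Z(γ) = Z(γ₀) = T` is compact (centralisers of regular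
elements are abelian, ★ `Subgroup.mul_comm_of_mem_centralizer_of_charpoly_separable`), so `Φ([γ], f_G) = 1`, i.e. `1 = Σ_u Φ_U(u, f_G)·Γ_u([γ])` near `1` on `T`.  Since
`Φ_U([1], h) = m·h(1)` (the orbit of `1` is a point), subtracting `f(1)∕f_G(1)` times this identity from the expansion of `f` ELIMINATES the trivial germ:
`Φ([γ], f) = f(1)∕f_G(1) + Σ_{u ∈ S, u ≠ [1]} (Φ_U(u, f) − f(1)·Φ_U(u, f_G)∕f_G(1))·Γ_u([γ])` — clause (EXP)+(Γ₁) of the residue with `c = 1∕f_G(1) ≠ 0` REAL and the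
germs at the NON-TRIVIAL unipotent classes only; NO constancy of `Γ₁` is used (print's `Γ₁ ≡ (−1)^q d(St)⁻¹`, [R₁], is then a corollary of homogeneity, not an input).
The transport «characteristic polynomial near `(X − 1)³`» ⇒ «eventually in `𝓝[T ∩ Gʳ] 1`» is continuity of the coefficients (★ `continuous_charpoly_coeff`) plus conjugation
invariance at the representative `out [γ]`.  The remaining clauses of the residue — a regular sequence `γ_n → 1` in `T` with `Γ_u([γ_n]) = q^{n·a_u}·g_u` (`‖q‖ > 1`,
`a_u ≥ 1`) for the non-trivial `u ∈ S` — are exactly the HYPOTHESIS `hhom` (from some index `n₀` on; the file re-indexes).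

* §1 `charpoly_coeff_out_mk`, `isRegularElt_out_mk` — the representative `out [γ]` has `γ`'s characteristic polynomial and regularity.
* §1 `centralizer_eq_of_mem_centralizer_of_isRegularElt` — `γ ∈ Z(γ₀)` regular, `γ₀` regular ⇒ `Z(γ) = Z(γ₀)` (in `U(Φ₃)(L⁺_v)`).
* §1 `classOrbitalIntegral_mk_one` — `Φ_{m}([1], h) = m_{[1]}(univ) · h(1)`.
* §2 **`germResidueAtTorus_of_epFunction_of_homogeneityRay`** — THE REDUCTION, core form (the Euler–Poincaré function as a binder: serves the wild places too);
  **`germResidueAtTorus_of_homogeneityRay`** — the head at a place that is not wildly ramified (the Euler–Poincaré function is ★ there).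
* §3 (ED. 2) **`germResidueAtTorus_of_homogeneityRay_nonsplit`** — the head at EVERY non-split place: the wildly ramified places are served by ★ row #21
  `K2E3EPFunctionGWild.epFunctionGWild` (p854998), so the residue along `T` now rests on the homogeneity letter ALONE at every non-split `v`.

HONEST LABEL: count-neutral helper; it closes no socket (row #3 stays open on the homogeneity letter, and at wildly ramified places also on row #21, the wild
Euler–Poincaré function); HC_CM is proved only modulo the 7 printed citations (2 remaining named inputs: hLiu418 = `stmt-HodgeConjecture-24832`, h413 =
`stmt-HodgeConjecture-24833`) until rung 0 closes.  No `sorry`, axioms ⊆ the trio, no `def`, no instance, no notation.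

## References
* [Rogawski1990] J. D. Rogawski, *Automorphic Representations of Unitary Groups in Three Variables*, Ann. of Math. Stud. 123 (1990): §8.1 Prop. 8.1.1 p. 112, Prop. 8.1.2 (b)
  p. 114, (8.1.1)–(8.1.2) p. 116 («the constant term in the germ expansion», [R₁]); §12.6 p. 187 (pseudo-coefficients ∕ Euler–Poincaré); Lemma 12.7.2 (proof) pp. 194–195.
* [HarishChandra1999AdmissibleDistributions] Harish-Chandra (notes by S. DeBacker, P. J. Sally, Jr.), *Admissible Invariant Distributions on Reductive p-adic Groups*, AMS
  ULS 16 (1999): Thm. 8.1 (1) p. 48 (homogeneity `Γ_O(t²H) = |t|^{r(O)−ℓ} Γ_O(H)`), §3.1 Lemma 3.2.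
* [Kottwitz1988] R. E. Kottwitz, *Tamagawa numbers*, Ann. of Math. 127 (1988), §2 Theorem 2.
* [R₁] J. D. Rogawski, *An application of the building to orbital integrals*, Compositio Math. 42 (1980∕81) 417–423.
-/

set_option autoImplicit false
-- the mandated namespace has the single-problem summit's repeated segment (`HodgeConjecture.HodgeConjecture`)
set_option linter.dupNamespace false

noncomputable section

open NumberField IsDedekindDomain MeasureTheory Filter Topology
open scoped Matrix MatrixGroups Valued
open Literature.NumberTheory.Rogawski1990 Literature.NumberTheory.Automorphic Literature.NumberTheory.Automorphic.UnitaryGroup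
open Literature.MeasureTheory.Group
open Summit.HodgeConjecture.HodgeConjecture.Cruxes.H413.F0P3cStCharTSEPGlueGNotWild

namespace Summit.HodgeConjecture.HodgeConjecture.Cruxes.H413.K2E3GermResidueAtCubicTorusOfHomogeneity

variable (L : Type) [Field L] [NumberField L] [IsCMField L] (v : HeightOneSpectrum (𝓞 ↥(maximalRealSubfield L)))

/-! ## §1 Representatives, centralisers of regular elements, the orbital integral at the identity class -/

/-- `out [γ]` is conjugate to `γ` in `U(Φ₃)(L⁺_v)`. [folklore] -/
theorem isConj_out_mk (γ : Gqs L v) : IsConj γ (Quotient.out (ConjClasses.mk γ)) :=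
  ConjClasses.mk_eq_mk_iff_isConj.1 (Quotient.out_eq (ConjClasses.mk γ)).symm

/-- Conjugate elements of `U(Φ₃)(L⁺_v)` have the same characteristic polynomial in `GL₃(L ⊗ L⁺_v)`. [cite: Rogawski1990, §3.1 p. 19] -/
theorem charpoly_eq_of_isConj {γ δ : Gqs L v} (h : IsConj γ δ) :
    ((δ.val : GL (Fin 3) (UnitaryGroup.LocalRing L v)).val : Matrix (Fin 3) (Fin 3) (UnitaryGroup.LocalRing L v)).charpoly =
      ((γ.val : GL (Fin 3) (UnitaryGroup.LocalRing L v)).val : Matrix (Fin 3) (Fin 3) (UnitaryGroup.LocalRing L v)).charpoly := by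
  obtain ⟨x, hx⟩ := isConj_iff.1 h
  rw [← hx]
  show (((x : Gqs L v).val * γ.val * (x : Gqs L v).val⁻¹ : GL (Fin 3) (UnitaryGroup.LocalRing L v)).val).charpoly = _
  rw [Units.val_mul, Units.val_mul, Matrix.coe_units_inv, Matrix.charpoly_units_conj]

/-- The representative `out [γ]` has the characteristic polynomial of `γ`. [cite: Rogawski1990, §3.1 p. 19] -/
theorem charpoly_out_mk (γ : Gqs L v) :
    (((Quotient.out (ConjClasses.mk γ) : Gqs L v).val : GL (Fin 3) (UnitaryGroup.LocalRing L v)).val : Matrix (Fin 3) (Fin 3) (UnitaryGroup.LocalRing L v)).charpoly =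
      ((γ.val : GL (Fin 3) (UnitaryGroup.LocalRing L v)).val : Matrix (Fin 3) (Fin 3) (UnitaryGroup.LocalRing L v)).charpoly :=
  charpoly_eq_of_isConj L v (isConj_out_mk L v γ)

/-- The representative `out [γ]` of a regular `γ` is regular. [cite: Rogawski1990, §3.1 p. 19] -/
theorem isRegularElt_out_mk {γ : Gqs L v} (hγ : IsRegularElt (γ.val : GL (Fin 3) (UnitaryGroup.LocalRing L v))) :
    IsRegularElt ((Quotient.out (ConjClasses.mk γ) : Gqs L v).val : GL (Fin 3) (UnitaryGroup.LocalRing L v)) := by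
  rw [isRegularElt_iff, charpoly_out_mk]
  exact hγ

/-- **The centraliser of a regular element of `U(Φ₃)(L⁺_v)` is abelian** (★ `Subgroup.mul_comm_of_mem_centralizer_of_charpoly_separable` over the product of fields
`L ⊗ L⁺_v = ∏_{w ∣ v} L_w`). [cite: Rogawski1990, §3.1 p. 19] -/
theorem mul_comm_of_mem_centralizer {γ : Gqs L v} (hγ : IsRegularElt (γ.val : GL (Fin 3) (UnitaryGroup.LocalRing L v)))
    {a b : Gqs L v} (ha : a ∈ Subgroup.centralizer ({γ} : Set (Gqs L v))) (hb : b ∈ Subgroup.centralizer ({γ} : Set (Gqs L v))) : a * b = b * a :=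
  Subgroup.mul_comm_of_mem_centralizer_of_charpoly_separable (K := fun w : PlacesOver L v => w.1.adicCompletion L)
    (RingHom.id (UnitaryGroup.LocalRing L v)) (fun _ _ h => h) _ γ hγ a ha b hb

/-- **`γ ∈ Z(γ₀)` regular and `γ₀` regular ⇒ `Z(γ) = Z(γ₀)`** — a compact Cartan subgroup `T = Z(γ₀)` of `U(Φ₃)(L⁺_v)` is the centraliser of EACH of its regular elements.
[cite: Rogawski1990, §3.1 p. 19; §3.6 p. 31] -/
theorem centralizer_eq_of_mem_centralizer_of_isRegularElt {γ₀ γ : Gqs L v} (hγ₀ : IsRegularElt (γ₀.val : GL (Fin 3) (UnitaryGroup.LocalRing L v)))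
    (hγ : IsRegularElt (γ.val : GL (Fin 3) (UnitaryGroup.LocalRing L v))) (hmem : γ ∈ Subgroup.centralizer ({γ₀} : Set (Gqs L v))) :
    Subgroup.centralizer ({γ} : Set (Gqs L v)) = Subgroup.centralizer ({γ₀} : Set (Gqs L v)) := by
  have h0 : γ₀ ∈ Subgroup.centralizer ({γ} : Set (Gqs L v)) := by
    rw [Subgroup.mem_centralizer_singleton_iff] at hmem ⊢
    exact hmem.symm
  have h1 : γ₀ ∈ Subgroup.centralizer ({γ₀} : Set (Gqs L v)) := by
    rw [Subgroup.mem_centralizer_singleton_iff]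
  ext a
  constructor
  · intro ha
    rw [Subgroup.mem_centralizer_singleton_iff]
    exact mul_comm_of_mem_centralizer L v hγ ha h0
  · intro ha
    rw [Subgroup.mem_centralizer_singleton_iff]
    exact mul_comm_of_mem_centralizer L v hγ₀ ha hmem

/-- **The orbital integral at the identity class is evaluation at `1` times the mass**: `Φ_m([1], h) = m_{[1]}(univ)·h(1)` (the orbit of `1` is the point `1`;
no finiteness of the mass is needed — an infinite mass gives `0 = 0·h(1)` by the Bochner convention). [cite: Rogawski1990, §4.9 p. 54] -/
theorem classOrbitalIntegral_mk_one {G : Type*} [Group G] [∀ γ : G, MeasurableSpace (G ⧸ Subgroup.centralizer ({γ} : Set G))]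
    (m : OrbitalMeasureFamily G) (h : G → ℂ) :
    classOrbitalIntegral m h (ConjClasses.mk 1) = ((m (ConjClasses.mk 1)).real Set.univ : ℂ) * h 1 := by
  have hout : (Quotient.out (ConjClasses.mk (1 : G)) : G) = 1 :=
    isConj_one_right.1 (ConjClasses.mk_eq_mk_iff_isConj.1 (Quotient.out_eq (ConjClasses.mk (1 : G))).symm)
  rw [classOrbitalIntegral_eq, orbitalIntegral_eq_integral_descConj]
  have hconst : descConj (Quotient.out (ConjClasses.mk (1 : G))) (Subgroup.centralizer ({(Quotient.out (ConjClasses.mk (1 : G)) : G)} : Set G))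
      (fun _ hg => Subgroup.mem_centralizer_singleton_iff.1 hg) h = fun _ => h 1 := by
    funext y
    induction y using QuotientGroup.induction_on with
    | H x => rw [descConj_mk, hout, mul_one, mul_inv_cancel]
  rw [hconst, integral_const, Complex.real_smul]

/-! ## §2 The reduction: residue along `T` ⟸ expansion datum + an Euler–Poincaré-type function + homogeneity of the non-trivial germs on one ray -/

set_option maxHeartbeats 1600000 in  -- statement-level `whnf` on the CM carriers (as ★ (G3) `exists_epFunction_G` and the socket module)
/-- **THE RESIDUE OF THE GERM EXPANSION ALONG A COMPACT CARTAN SUBGROUP `T = Z(γ₀) ≤ U(Φ₃)(L⁺_v)` — CORE FORM, the Euler–Poincaré function as a BINDER** (so that the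
same reduction serves the wildly ramified places once row #21 `sig_K2E3EPFunctionGWild` delivers `f_G` there).  Hypotheses: ANY orbital-measure family `mQv`; `T = Z(γ₀)`
compact, `γ₀` regular; `f_G ∈ C_c^∞` with `f_G(1)` REAL NON-ZERO and `Φ_{mQv}([γ], f_G) = 1` at every regular `γ` with compact centraliser (clauses of ★ `exists_epFunction_G`);
an expansion datum `(S, mU, Γ)` near `1` for `mQv` (`hgerm` = the last conjunct of ★ `ShalikaGermExpansionNonsplit`, verbatim); a sequence `γseq` of regular elements of `T`
tending to `1`, `q` with `‖q‖ > 1`, exponents `a u ≥ 1` and constants `g u` with `Γ u [γseq n] = q^{n·a u}·g u` from some index `n₀` on, for every `u ∈ S` other than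
the identity class (`hhom`, [Rogawski1990, Prop. 8.1.2 (b)] read along the ray `exp(ϖ^{2n}Y)`).  Conclusion: ★ `ShalikaGermResidueAtTorus L Φ₃ v mQv T` with `c = 1∕f_G(1)`.
[cite: Rogawski1990, §8.1 Prop. 8.1.1 p. 112; Prop. 8.1.2 (b) p. 114; (8.1.1)–(8.1.2) p. 116; §12.7 p. 194] [cite: Kottwitz1988, §2 Theorem 2]
[cite: HarishChandra1999AdmissibleDistributions, Thm. 8.1 p. 48] -/
theorem germResidueAtTorus_of_epFunction_of_homogeneityRay
    [∀ γ : Gqs L v, MeasurableSpace (Gqs L v ⧸ Subgroup.centralizer ({γ} : Set (Gqs L v)))]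
    (mQv : OrbitalMeasureFamily (Gqs L v))
    -- the compact Cartan subgroup
    {T : Subgroup (Gqs L v)} (hT : IsCompact ((T : Subgroup (Gqs L v)) : Set (Gqs L v)))
    {γ₀ : Gqs L v} (hγ₀ : IsRegularElt (γ₀.val : GL (Fin 3) (UnitaryGroup.LocalRing L v))) (hTγ₀ : T = Subgroup.centralizer ({γ₀} : Set (Gqs L v)))
    -- an Euler–Poincaré-type function for `mQv`
    {fG : Gqs L v → ℂ} (hfGs : IsLocSmooth fG) (hfGim : (fG 1).im = 0) (hfGre : (fG 1).re ≠ 0)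
    (hell : ∀ γ : Gqs L v, IsRegularElt (γ.val : GL (Fin 3) (UnitaryGroup.LocalRing L v)) →
      IsCompact ((Subgroup.centralizer ({γ} : Set (Gqs L v))) : Set (Gqs L v)) → classOrbitalIntegral mQv fG (ConjClasses.mk γ) = 1)
    -- the expansion datum near `1`
    (S : Finset (ConjClasses (Gqs L v))) (mU : OrbitalMeasureFamily (Gqs L v)) (Γ : ConjClasses (Gqs L v) → ConjClasses (Gqs L v) → ℂ)
    (hgerm : ∀ f : Gqs L v → ℂ, IsLocSmooth f →
      ∃ W ∈ 𝓝 (fun i : Fin 3 => ((1 : Matrix (Fin 3) (Fin 3) (UnitaryGroup.LocalRing L v)).charpoly).coeff i),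
        ∀ c : ConjClasses (Gqs L v),
          IsRegularElt ((Quotient.out c : Gqs L v).val : GL (Fin 3) (UnitaryGroup.LocalRing L v)) →
          (fun i : Fin 3 => ((Quotient.out c : Gqs L v).val : GL (Fin 3) (UnitaryGroup.LocalRing L v)).val.charpoly.coeff i) ∈ W →
            classOrbitalIntegral mQv f c = ∑ u ∈ S, classOrbitalIntegral mU f u * Γ u c)
    -- homogeneity of the non-trivial germs along one ray of `T`
    (γseq : ℕ → Gqs L v) (hγT : ∀ n, γseq n ∈ (T : Set (Gqs L v)) ∧ IsRegularElt ((γseq n).val : GL (Fin 3) (UnitaryGroup.LocalRing L v)))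
    (hγ1 : Tendsto γseq atTop (𝓝 (1 : Gqs L v)))
    (q : ℂ) (hq : 1 < ‖q‖) (a : ConjClasses (Gqs L v) → ℕ) (g : ConjClasses (Gqs L v) → ℂ) (n₀ : ℕ)
    (ha : ∀ u ∈ S, u ≠ ConjClasses.mk 1 → 1 ≤ a u)
    (hhom : ∀ u ∈ S, u ≠ ConjClasses.mk 1 → ∀ n, n₀ ≤ n → Γ u (ConjClasses.mk (γseq n)) = q ^ (n * a u) * g u) :
    ShalikaGermResidueAtTorus L (qsForm L) v mQv T := by
  classical
  -- the constant `c = 1 / f_G(1)`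
  have hfG1 : fG 1 = (((fG 1).re : ℝ) : ℂ) := by
    apply Complex.ext <;> simp [hfGim]
  have hfG1ne : fG 1 ≠ 0 := by
    rw [hfG1]; exact_mod_cast hfGre
  set κ : ℂ := (fG 1)⁻¹ with hκdef
  have hκ : κ * fG 1 = 1 := inv_mul_cancel₀ hfG1ne
  have hcκ : (((fG 1).re⁻¹ : ℝ) : ℂ) = κ := by
    rw [hκdef, Complex.ofReal_inv, ← hfG1]
  -- the data of the residue
  refine ⟨(fG 1).re⁻¹, inv_ne_zero hfGre, ConjClasses (Gqs L v), S.erase (ConjClasses.mk 1),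
    fun u f => classOrbitalIntegral mU f u - f 1 * κ * classOrbitalIntegral mU fG u, fun u γ => Γ u (ConjClasses.mk γ),
    fun n => γseq (n + n₀), q, a, fun u => q ^ (n₀ * a u) * g u, ?_, fun n => hγT (n + n₀), hγ1.comp (tendsto_add_atTop_nat n₀), hq,
    fun u hu => ha u (Finset.mem_of_mem_erase hu) (Finset.ne_of_mem_erase hu), fun u hu n => ?_⟩
  · -- (EXP) + (Γ₁): the expansion near `1` along `T`, trivial germ eliminated by the Euler–Poincaré identity
    intro f hf
    obtain ⟨Wf, hWf, hexpf⟩ := hgerm f hf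
    obtain ⟨WG, hWG, hexpG⟩ := hgerm fG hfGs
    -- the coefficient map is continuous and takes the base point at `γ = 1`
    set χ : Gqs L v → (Fin 3 → UnitaryGroup.LocalRing L v) :=
      fun γ i => (((γ.val : GL (Fin 3) (UnitaryGroup.LocalRing L v)).val : Matrix (Fin 3) (Fin 3) (UnitaryGroup.LocalRing L v)).charpoly).coeff i with hχdef
    have hχc : Continuous χ := by
      have h2 : Continuous fun γ : Gqs L v => ((γ.val : GL (Fin 3) (UnitaryGroup.LocalRing L v)).val : Matrix (Fin 3) (Fin 3) (UnitaryGroup.LocalRing L v)) :=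
        Units.continuous_val.comp continuous_subtype_val
      exact continuous_pi fun i => (Literature.LinearAlgebra.Matrix.continuous_charpoly_coeff (i : ℕ)).comp h2
    have h11 : ((1 : Gqs L v).val : GL (Fin 3) (UnitaryGroup.LocalRing L v)) = 1 := rfl
    have hχ1 : χ 1 = fun i : Fin 3 => ((1 : Matrix (Fin 3) (Fin 3) (UnitaryGroup.LocalRing L v)).charpoly).coeff i := by
      funext i
      simp only [hχdef, h11, Units.val_one]
    have hN : χ ⁻¹' (Wf ∩ WG) ∈ 𝓝 (1 : Gqs L v) :=
      hχc.continuousAt.preimage_mem_nhds (by rw [hχ1]; exact inter_mem hWf hWG)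
    rw [eventually_nhdsWithin_iff]
    filter_upwards [hN] with γ hγW hγA
    obtain ⟨hγT', hγr⟩ := hγA
    have hγr' : IsRegularElt (γ.val : GL (Fin 3) (UnitaryGroup.LocalRing L v)) := hγr
    -- the representative of `[γ]`
    have hreg : IsRegularElt ((Quotient.out (ConjClasses.mk γ) : Gqs L v).val : GL (Fin 3) (UnitaryGroup.LocalRing L v)) := isRegularElt_out_mk L v hγr'
    have hcoef : (fun i : Fin 3 => ((Quotient.out (ConjClasses.mk γ) : Gqs L v).val : GL (Fin 3) (UnitaryGroup.LocalRing L v)).val.charpoly.coeff i) = χ γ := by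
      funext i
      simp only [hχdef, charpoly_out_mk]
    have hWf' : (fun i : Fin 3 => ((Quotient.out (ConjClasses.mk γ) : Gqs L v).val : GL (Fin 3) (UnitaryGroup.LocalRing L v)).val.charpoly.coeff i) ∈ Wf := by
      rw [hcoef]; exact hγW.1
    have hWG' : (fun i : Fin 3 => ((Quotient.out (ConjClasses.mk γ) : Gqs L v).val : GL (Fin 3) (UnitaryGroup.LocalRing L v)).val.charpoly.coeff i) ∈ WG := by
      rw [hcoef]; exact hγW.2
    have Ef := hexpf (ConjClasses.mk γ) hreg hWf'
    have EG := hexpG (ConjClasses.mk γ) hreg hWG'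
    -- `Z(γ) = T` is compact, so the Euler–Poincaré orbital integral at `[γ]` is `1`
    have hZ : Subgroup.centralizer ({γ} : Set (Gqs L v)) = T := by
      rw [hTγ₀]
      exact centralizer_eq_of_mem_centralizer_of_isRegularElt L v hγ₀ hγr' (by rw [← hTγ₀]; exact hγT')
    have hcpt : IsCompact ((Subgroup.centralizer ({γ} : Set (Gqs L v))) : Set (Gqs L v)) := by
      rw [hZ]; exact hT
    have hone : classOrbitalIntegral mQv fG (ConjClasses.mk γ) = 1 := hell γ hγr' hcpt
    rw [hone] at EG
    -- bookkeeping: split off the identity class when it occurs in `S`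
    rw [hcκ]
    have key : ∑ u ∈ S.erase (ConjClasses.mk 1), (classOrbitalIntegral mU f u - f 1 * κ * classOrbitalIntegral mU fG u) * Γ u (ConjClasses.mk γ) =
        (∑ u ∈ S.erase (ConjClasses.mk 1), classOrbitalIntegral mU f u * Γ u (ConjClasses.mk γ)) -
          f 1 * κ * ∑ u ∈ S.erase (ConjClasses.mk 1), classOrbitalIntegral mU fG u * Γ u (ConjClasses.mk γ) := by
      simp only [sub_mul, Finset.sum_sub_distrib, Finset.mul_sum, mul_assoc]
    rw [key]
    by_cases h1 : ConjClasses.mk 1 ∈ S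
    · have hsplf := Finset.add_sum_erase S (fun u => classOrbitalIntegral mU f u * Γ u (ConjClasses.mk γ)) h1
      have hsplG := Finset.add_sum_erase S (fun u => classOrbitalIntegral mU fG u * Γ u (ConjClasses.mk γ)) h1
      rw [classOrbitalIntegral_mk_one] at hsplf hsplG
      set mass : ℂ := ((mU (ConjClasses.mk 1)).real Set.univ : ℂ)
      set Γ₁ : ℂ := Γ (ConjClasses.mk 1) (ConjClasses.mk γ)
      rw [← hsplf] at Ef
      rw [← hsplG] at EG
      linear_combination Ef - f 1 * κ * EG + (-(mass * f 1 * Γ₁)) * hκ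
    · rw [Finset.erase_eq_of_notMem h1]
      linear_combination Ef - f 1 * κ * EG
  · -- (HOM) along the re-indexed ray
    have hu' : u ∈ S := Finset.mem_of_mem_erase hu
    have hne : u ≠ ConjClasses.mk 1 := Finset.ne_of_mem_erase hu
    show Γ u (ConjClasses.mk (γseq (n + n₀))) = q ^ (n * a u) * (q ^ (n₀ * a u) * g u)
    rw [hhom u hu' hne (n + n₀) (Nat.le_add_left n₀ n), add_mul, pow_add]
    ring

set_option maxHeartbeats 1600000 in  -- statement-level `whnf` on the CM carriers (as ★ (G3) `exists_epFunction_G` and the socket module)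
/-- **THE RESIDUE OF THE GERM EXPANSION ALONG A COMPACT CARTAN SUBGROUP `T = Z(γ₀) ≤ U(Φ₃)(L⁺_v)` AT A PLACE THAT IS NOT WILDLY RAMIFIED, FROM HOMOGENEITY OF THE
NON-TRIVIAL GERMS ON ONE RAY.**  Hypotheses: `v` non-split in `L` (`hns`) and not wildly ramified (`hv`: unramified in `L` or `|2|_v = 1`); `νQv` a Haar measure and `mQv`
the CANONICAL orbital-measure family on the regular classes (the socket's prefix); `T = Z(γ₀)` compact, `γ₀` regular; an expansion datum `(S, mU, Γ)` near `1` (`hgerm` = the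
last conjunct of ★ `ShalikaGermExpansionNonsplit`, verbatim — delivered for the canonical family by ★ `UnitaryGroup.shalikaGermExpansionNonsplit_antidiagOne_three` via ★
`IsCanonical.isAdmissibleOn`); homogeneity of its non-trivial germs on one ray of `T` (`hhom`).  Conclusion: ★ `ShalikaGermResidueAtTorus L Φ₃ v mQv T`, the constant being
`c = 1∕f_G(1)` for Kottwitz's Euler–Poincaré function `f_G` (★ `exists_epFunction_G_of_not_wild`).  The socket `sig_K2E3GermResidueAtCubicTorus` is this theorem plus the
homogeneity letter (and, at wildly ramified places, plus row #21's Euler–Poincaré function through the core form above).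
[cite: Rogawski1990, §8.1 Prop. 8.1.1 p. 112; Prop. 8.1.2 (b) p. 114; (8.1.1)–(8.1.2) p. 116; §12.7 p. 194] [cite: Kottwitz1988, §2 Theorem 2]
[cite: HarishChandra1999AdmissibleDistributions, Thm. 8.1 p. 48] -/
theorem germResidueAtTorus_of_homogeneityRay (hns : ∀ w : PlacesOver L v, IsCMField.complexConj L • w.1 = w.1)
    (hv : Algebra.IsUnramifiedIn (𝓞 L) v.asIdeal ∨ Valued.v (2 : v.adicCompletion ↥(maximalRealSubfield L)) = 1)
    [MeasurableSpace (Gqs L v)] [BorelSpace (Gqs L v)]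
    [∀ γ : Gqs L v, MeasurableSpace (Gqs L v ⧸ Subgroup.centralizer ({γ} : Set (Gqs L v)))]
    [∀ γ : Gqs L v, BorelSpace (Gqs L v ⧸ Subgroup.centralizer ({γ} : Set (Gqs L v)))]
    (νQv : Measure (Gqs L v)) [νQv.IsHaarMeasure] [νQv.IsMulRightInvariant]
    {mQv : OrbitalMeasureFamily (Gqs L v)}
    (hcanQ : mQv.IsCanonical (fun γ => IsRegularElt (γ.val : GL (Fin 3) (UnitaryGroup.LocalRing L v))) νQv)
    -- the compact Cartan subgroup
    {T : Subgroup (Gqs L v)} (hT : IsCompact ((T : Subgroup (Gqs L v)) : Set (Gqs L v)))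
    {γ₀ : Gqs L v} (hγ₀ : IsRegularElt (γ₀.val : GL (Fin 3) (UnitaryGroup.LocalRing L v))) (hTγ₀ : T = Subgroup.centralizer ({γ₀} : Set (Gqs L v)))
    -- the expansion datum near `1`
    (S : Finset (ConjClasses (Gqs L v))) (mU : OrbitalMeasureFamily (Gqs L v)) (Γ : ConjClasses (Gqs L v) → ConjClasses (Gqs L v) → ℂ)
    (hgerm : ∀ f : Gqs L v → ℂ, IsLocSmooth f →
      ∃ W ∈ 𝓝 (fun i : Fin 3 => ((1 : Matrix (Fin 3) (Fin 3) (UnitaryGroup.LocalRing L v)).charpoly).coeff i),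
        ∀ c : ConjClasses (Gqs L v),
          IsRegularElt ((Quotient.out c : Gqs L v).val : GL (Fin 3) (UnitaryGroup.LocalRing L v)) →
          (fun i : Fin 3 => ((Quotient.out c : Gqs L v).val : GL (Fin 3) (UnitaryGroup.LocalRing L v)).val.charpoly.coeff i) ∈ W →
            classOrbitalIntegral mQv f c = ∑ u ∈ S, classOrbitalIntegral mU f u * Γ u c)
    -- homogeneity of the non-trivial germs along one ray of `T`
    (γseq : ℕ → Gqs L v) (hγT : ∀ n, γseq n ∈ (T : Set (Gqs L v)) ∧ IsRegularElt ((γseq n).val : GL (Fin 3) (UnitaryGroup.LocalRing L v)))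
    (hγ1 : Tendsto γseq atTop (𝓝 (1 : Gqs L v)))
    (q : ℂ) (hq : 1 < ‖q‖) (a : ConjClasses (Gqs L v) → ℕ) (g : ConjClasses (Gqs L v) → ℂ) (n₀ : ℕ)
    (ha : ∀ u ∈ S, u ≠ ConjClasses.mk 1 → 1 ≤ a u)
    (hhom : ∀ u ∈ S, u ≠ ConjClasses.mk 1 → ∀ n, n₀ ≤ n → Γ u (ConjClasses.mk (γseq n)) = q ^ (n * a u) * g u) :
    ShalikaGermResidueAtTorus L (qsForm L) v mQv T := by
  -- Kottwitz's Euler–Poincaré function: `f_G(1)` real negative, canonical orbital integral `1` on the regular classes with compact centraliser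
  obtain ⟨fG, hfGs, -, -, -, hfGim, hfGre, hell, -⟩ := exists_epFunction_G_of_not_wild L v hns hv νQv hcanQ
  exact germResidueAtTorus_of_epFunction_of_homogeneityRay L v mQv hT hγ₀ hTγ₀ hfGs hfGim hfGre.ne hell S mU Γ hgerm γseq hγT hγ1 q hq a g n₀ ha hhom

/-! ## §3 (ED. 2) The head at EVERY non-split place — the Euler–Poincaré function is ★ at the wild places too (row #21, p854998) -/

omit [IsCMField L] in
/-- `|2|_w ≤ 1` in `L_w` (ultrametric inequality on `1 + 1`). [folklore] -/
theorem valued_two_le_one (w : HeightOneSpectrum (𝓞 L)) : Valued.v (2 : w.adicCompletion L) ≤ 1 := by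
  have h : (2 : w.adicCompletion L) = 1 + 1 := by norm_num
  rw [h]
  exact (Valuation.map_add _ _ _).trans (by rw [Valuation.map_one, max_self])

set_option maxHeartbeats 1600000 in  -- statement-level `whnf` on the CM carriers (as ★ (G3) `exists_epFunction_G` and the socket module)
/-- **THE RESIDUE OF THE GERM EXPANSION ALONG A COMPACT CARTAN SUBGROUP `T = Z(γ₀) ≤ U(Φ₃)(L⁺_v)` AT EVERY NON-SPLIT PLACE, FROM HOMOGENEITY OF THE NON-TRIVIAL
GERMS ON ONE RAY** (ED. 2).  As `germResidueAtTorus_of_homogeneityRay` WITHOUT the place hypothesis `hv`: at the place `w ∣ v`, either `e(w|v) = 1 ∨ |2|_w = 1`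
(★ (G3)-NOT-WILD `exists_epFunction_G_of_ramificationIdx'_or_valued_two`) or `e(w|v) ≠ 1 ∧ |2|_w < 1` (★ row #21 `K2E3EPFunctionGWild.epFunctionGWild`) supplies
Kottwitz's Euler–Poincaré function, and the core `germResidueAtTorus_of_epFunction_of_homogeneityRay` concludes.  With this head the socket
`sig_K2E3GermResidueAtCubicTorus` is EXACTLY: ★ `ShalikaGermExpansionNonsplit` (its own hypothesis) + the homogeneity letter for the expansion datum.
[cite: Rogawski1990, §8.1 Prop. 8.1.1 p. 112; Prop. 8.1.2 (b) p. 114; (8.1.1)–(8.1.2) p. 116; §12.7 p. 194] [cite: Kottwitz1988, §2 Theorem 2]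
[cite: HarishChandra1999AdmissibleDistributions, Thm. 8.1 p. 48] -/
theorem germResidueAtTorus_of_homogeneityRay_nonsplit (hns : ∀ w : PlacesOver L v, IsCMField.complexConj L • w.1 = w.1)
    [MeasurableSpace (Gqs L v)] [BorelSpace (Gqs L v)]
    [∀ γ : Gqs L v, MeasurableSpace (Gqs L v ⧸ Subgroup.centralizer ({γ} : Set (Gqs L v)))]
    [∀ γ : Gqs L v, BorelSpace (Gqs L v ⧸ Subgroup.centralizer ({γ} : Set (Gqs L v)))]
    (νQv : Measure (Gqs L v)) [νQv.IsHaarMeasure] [νQv.IsMulRightInvariant]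
    {mQv : OrbitalMeasureFamily (Gqs L v)}
    (hcanQ : mQv.IsCanonical (fun γ => IsRegularElt (γ.val : GL (Fin 3) (UnitaryGroup.LocalRing L v))) νQv)
    -- the compact Cartan subgroup
    {T : Subgroup (Gqs L v)} (hT : IsCompact ((T : Subgroup (Gqs L v)) : Set (Gqs L v)))
    {γ₀ : Gqs L v} (hγ₀ : IsRegularElt (γ₀.val : GL (Fin 3) (UnitaryGroup.LocalRing L v))) (hTγ₀ : T = Subgroup.centralizer ({γ₀} : Set (Gqs L v)))
    -- the expansion datum near `1`
    (S : Finset (ConjClasses (Gqs L v))) (mU : OrbitalMeasureFamily (Gqs L v)) (Γ : ConjClasses (Gqs L v) → ConjClasses (Gqs L v) → ℂ)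
    (hgerm : ∀ f : Gqs L v → ℂ, IsLocSmooth f →
      ∃ W ∈ 𝓝 (fun i : Fin 3 => ((1 : Matrix (Fin 3) (Fin 3) (UnitaryGroup.LocalRing L v)).charpoly).coeff i),
        ∀ c : ConjClasses (Gqs L v),
          IsRegularElt ((Quotient.out c : Gqs L v).val : GL (Fin 3) (UnitaryGroup.LocalRing L v)) →
          (fun i : Fin 3 => ((Quotient.out c : Gqs L v).val : GL (Fin 3) (UnitaryGroup.LocalRing L v)).val.charpoly.coeff i) ∈ W →
            classOrbitalIntegral mQv f c = ∑ u ∈ S, classOrbitalIntegral mU f u * Γ u c)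
    -- homogeneity of the non-trivial germs along one ray of `T`
    (γseq : ℕ → Gqs L v) (hγT : ∀ n, γseq n ∈ (T : Set (Gqs L v)) ∧ IsRegularElt ((γseq n).val : GL (Fin 3) (UnitaryGroup.LocalRing L v)))
    (hγ1 : Tendsto γseq atTop (𝓝 (1 : Gqs L v)))
    (q : ℂ) (hq : 1 < ‖q‖) (a : ConjClasses (Gqs L v) → ℕ) (g : ConjClasses (Gqs L v) → ℂ) (n₀ : ℕ)
    (ha : ∀ u ∈ S, u ≠ ConjClasses.mk 1 → 1 ≤ a u)
    (hhom : ∀ u ∈ S, u ≠ ConjClasses.mk 1 → ∀ n, n₀ ≤ n → Γ u (ConjClasses.mk (γseq n)) = q ^ (n * a u) * g u) :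
    ShalikaGermResidueAtTorus L (qsForm L) v mQv T := by
  obtain ⟨w⟩ := PlacesOver.nonempty L v
  by_cases hw : v.asIdeal.ramificationIdx' w.1.asIdeal = 1 ∨ Valued.v (2 : w.1.adicCompletion L) = 1
  · obtain ⟨fG, hfGs, -, -, -, hfGim, hfGre, hell, -⟩ := exists_epFunction_G_of_ramificationIdx'_or_valued_two L v hns w hw νQv hcanQ
    exact germResidueAtTorus_of_epFunction_of_homogeneityRay L v mQv hT hγ₀ hTγ₀ hfGs hfGim hfGre.ne hell S mU Γ hgerm γseq hγT hγ1 q hq a g n₀ ha hhom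
  · rw [not_or] at hw
    obtain ⟨fG, hfGs, -, -, -, hfGim, hfGre, hell, -⟩ :=
      K2E3EPFunctionGWild.epFunctionGWild L v hns w hw.1 (lt_of_le_of_ne (valued_two_le_one L w.1) hw.2) νQv mQv hcanQ
    exact germResidueAtTorus_of_epFunction_of_homogeneityRay L v mQv hT hγ₀ hTγ₀ hfGs hfGim hfGre.ne hell S mU Γ hgerm γseq hγT hγ1 q hq a g n₀ ha hhom


end Summit.HodgeConjecture.HodgeConjecture.Cruxes.H413.K2E3GermResidueAtCubicTorusOfHomogeneity

end
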